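import Summits.Ventures.YMGap.FlowData.KWeightTailOperator

/-!
# Venture YMGap, track Y3 FLOW-DATA — TAIL-A AT OPERATOR LEVEL, LEVEL 1: the SECOND level of a sector from the kept
# Galerkin block — `λ₁ ≤ λ↓₁(G) + κ‖A‖²` by a deflation test, `λ↓₁(G)‖x‖² ≤ ⟪x, T x⟫` on a trial state `x ⊥ Ω`

HONEST FRAMING: venture file of the cell `pub-ymgap` (QuantumFields programme), track Y3, lineage A (seat flow-eng-1).
Abstract operator theory on a real inner-product space plus finite real linear algebra; NO lattice object, no number,
no row, nothing about limits or a mass gap.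

WHY.  `KWeightTailOperator` (level 0) lifts the kept-set tail theorem TAIL-A to the operator norms `‖T‖`, `‖T ∘ P_e‖` of the
typed tube operator.  The remaining row types of the Y3 table are SECOND levels of a sector: `m′ = log λ̂₀ − log λ̂*` with
`λ̂* = ‖T ∘ (P_0 − P_Ω)‖` (`RectTubeExcitedEigenvalue`: the largest eigenvalue on the trivial-flux states orthogonal to the
vacuum `Ω`), and `m` likewise inside the fully symmetric sector.  `P_0 − P_Ω` involves the unknown vacuum, so the level-0
theorem gives no computable bound; the engines certify instead the SECOND eigenvalue `λ↓₁` of the sector's kept block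
(deflation upper bound / two Ritz vectors: `RitzDeflation.eigenvalues₀_le_of_deflation_posSemidef`,
`le_eigenvalues₀_of_ritz_posSemidef`).  This file is the operator-level min–max step at level 1, in the vocabulary of file 1:
a bounded symmetric `T` on `E`; a «sector» map `Q` entering ONLY through `Q Ω = Ω`, `Q φ = φ`, `Q g_i = g_i` and the
factorisation ON THE SECTOR `Q x = x → ⟪x, T x⟫ = ⟪A x, 𝒦 (A x)⟫` (`A` = half spatial weight ∘ sector projection for the
tube); `𝒦 ⪰ 0` diagonal on the orthonormal kept family `f_i` (`𝒦 f_i = q_i f_i`), dropped weights `≤ κ`;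
`⟪g_i, ·⟫ = ⟪f_i, A ·⟫`; kept block `G_ij = √q_i √q_j ⟪g_i, g_j⟫`; trial vectors `Z c = Σ_i c_i √q_i g_i`.

* UPPER **`second_le_of_deflation`**: if `cᵀGc ≤ μ cᵀc` for every `c ⊥ u` (ONE deflation vector `u` — what the PSD test
  `μ·1 − G + τ u uᵀ ⪰ 0` delivers) and `Ω ⊥ φ` are unit vectors of the sector with `⟪Ω, Tφ⟫ = 0`, `⟪Ω, TΩ⟫, ⟪φ, Tφ⟫ ≥ ℓ`,
  then `ℓ ≤ μ + κ‖A‖²` (consumer: `Ω` = vacuum, `φ` = the excited eigenvector of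
  `RectTubeExcitedEigenvalue.exists_eigenvector_rectTubeExcitedNorm`, `ℓ = λ̂*`).  Proof: some unit `ψ = aΩ + bφ` is
  orthogonal to `Z u`; its form is `≥ ℓ` and, by file 1's splitting at the coefficient vector `Z†ψ ⊥ u`, `≤ μ + κ‖A‖²`.
* LOWER **`exists_trial_orthogonal_of_two_ritz`**: two linearly independent coefficient vectors `c₀, c₁` whose pencil has
  Ritz values `≥ σ > 0` give, for ANY `Ω`, a state `x ≠ 0` with `Q x = x`, `⟪Ω, x⟫ = 0`, `σ‖x‖² ≤ ⟪x, T x⟫` (consumer: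
  `RectTubeMassGapPrime.rectTubeExcitedNorm_mul_ge_inner` then gives `σ ≤ λ̂*`).  Proof: `x = Z(a c₀ + b c₁) ⊥ Ω` exists and
  `⟪x, Tx⟫ ≥ ‖G c‖² ≥ (cᵀGc)²/cᵀc ≥ σ cᵀGc = σ‖x‖²`.
* EIGENVALUE FORMS (`Matrix.IsHermitian.eigenvalues₀` of `G`, `|ι| ≥ 2`): `dotProduct_mulVec_le_eigenvalues₀_one`,
  `eigenvalues₀_one_nonneg`, `eigenvalues₀_one_mul_le_of_span`, **`second_le_eigenvalues₀_one_add`**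
  (`ℓ ≤ λ↓₁(G) + κ‖A‖²`), **`exists_trial_orthogonal_eigenvalues₀_one`** (`λ↓₁(G) > 0 ⇒ ∃ x ⊥ Ω` in the sector,
  `x ≠ 0`, `λ↓₁(G)‖x‖² ≤ ⟪x, T x⟫`); tools `trial_add`, `trial_smul`, `apply_trial_eq`, `keptForm_le_of_coeff`,
  `form_trial_ge`, `form_combination_ge` and the `EuclideanSpace` bridges `inner_toLp_toLp_real`,
  `inner_toEuclideanLin_toLp_real`.

WHAT IS NOT HERE: levels `≥ 2`; the identification of `A`, `𝒦`, `f_i`, `q_i`, `κ`, `Q` for the tube (character calculus; the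
vacuum package of `RectTubeMassGapPrime`); numbers.  With it, a certified `[lo, hi] ∋ λ↓₁` of the `e = 0` (resp. `A₁`) kept
block reads `lo ≤ λ̂* ≤ hi + κ_T Ω_w` for the typed excited level, hence an enclosure of `m′` (resp. `m`) by file 2's rows.

References: R. A. Horn, C. R. Johnson, *Matrix Analysis*, 2nd ed. (2013), Thm. 4.2.6 (Courant–Fischer), Cor. 4.3.9,
Thm. 4.3.21 (deflation / Rayleigh–Ritz), Thm. 4.3.1 (Weyl) [cite: HornJohnson2013, Thm 4.2.6; Cor 4.3.9; Thm 4.3.21];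
M. Reed, B. Simon IV (1978) Thm. XIII.1 (min–max) [cite: ReedSimonIV1978, Thm XIII.1]; the cell's FLOW-REFEREE.md FR-18
and HOME/pub-ymgap-flow-eng-1/ENGINE.md §3 (iii) (2026-08-22/25).
-/

noncomputable section

open scoped InnerProductSpace BigOperators
open Matrix Finset WithLp

namespace Summit.Ventures.YMGap.FlowData

namespace KWeightTailOperator

open Literature.Analysis.InnerProduct

/-! ### §6 Trial vectors: linearity, sector membership, the pointwise kept bound, the form at a Ritz witness -/

section Trial

variable {E F : Type*} [NormedAddCommGroup E] [InnerProductSpace ℝ E] [NormedAddCommGroup F]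
  [InnerProductSpace ℝ F] {ι : Type*} [Fintype ι]
  {T Q : E →L[ℝ] E} {A : E →L[ℝ] F} {𝒦 : F →L[ℝ] F} {f : ι → F} {q : ι → ℝ} {g : ι → E} {G : Matrix ι ι ℝ}

/-- `Z (c + d) = Z c + Z d`. [folklore] -/
theorem trial_add (c d : ι → ℝ) :
    ∑ i, ((c + d) i * √(q i)) • g i = ∑ i, (c i * √(q i)) • g i + ∑ i, (d i * √(q i)) • g i := by
  rw [← Finset.sum_add_distrib]
  refine Finset.sum_congr rfl fun i _ => ?_
  rw [Pi.add_apply, add_mul, add_smul]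

/-- `Z (a c) = a Z c`. [folklore] -/
theorem trial_smul (a : ℝ) (c : ι → ℝ) :
    ∑ i, ((a • c) i * √(q i)) • g i = a • ∑ i, (c i * √(q i)) • g i := by
  rw [Finset.smul_sum]
  refine Finset.sum_congr rfl fun i _ => ?_
  rw [Pi.smul_apply, smul_eq_mul, mul_assoc, mul_smul]

/-- Trial vectors lie in the sector: `Q g_i = g_i ⇒ Q (Z c) = Z c`. [folklore] -/
theorem apply_trial_eq (hgQ : ∀ i, Q (g i) = g i) (c : ι → ℝ) :
    Q (∑ i, (c i * √(q i)) • g i) = ∑ i, (c i * √(q i)) • g i := by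
  rw [map_sum]
  exact Finset.sum_congr rfl fun i _ => by rw [map_smul, hgQ]

/-- File 1's `keptForm_le` with the block test used only AT the coefficient vector `c = Z† x` of the given `x`
(`c_i = √q_i ⟪f_i, A x⟫`): `cᵀGc ≤ μ cᵀc ⇒ Σ_i q_i ⟪f_i, A x⟫² ≤ μ‖x‖²`. [cite: HornJohnson2013, Thm 1.3.22] -/
theorem keptForm_le_of_coeff (hq0 : ∀ i, 0 ≤ q i) (hg : ∀ i x, ⟪g i, x⟫_ℝ = ⟪f i, A x⟫_ℝ)
    (hG : ∀ i j, G i j = √(q i) * √(q j) * ⟪g i, g j⟫_ℝ) {μ : ℝ} (hμ0 : 0 ≤ μ) (x : E)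
    (hμx : (fun i => √(q i) * ⟪f i, A x⟫_ℝ) ⬝ᵥ (G *ᵥ fun i => √(q i) * ⟪f i, A x⟫_ℝ) ≤
      μ * ((fun i => √(q i) * ⟪f i, A x⟫_ℝ) ⬝ᵥ fun i => √(q i) * ⟪f i, A x⟫_ℝ)) :
    ∑ i, q i * ⟪f i, A x⟫_ℝ ^ 2 ≤ μ * ‖x‖ ^ 2 := by
  set c : ι → ℝ := fun i => √(q i) * ⟪f i, A x⟫_ℝ with hc
  set S : ℝ := ∑ i, q i * ⟪f i, A x⟫_ℝ ^ 2 with hS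
  have hSc : S = c ⬝ᵥ c := by
    rw [hS, keptForm_eq_sum_sq hq0 x, dotProduct]
    exact Finset.sum_congr rfl fun i _ => sq (c i)
  have hS0 : 0 ≤ S := by
    rw [hSc, dotProduct]; exact Finset.sum_nonneg fun i _ => mul_self_nonneg (c i)
  set z : E := ∑ i, (c i * √(q i)) • g i with hz
  have hzx : ⟪z, x⟫_ℝ = S := by rw [hz, inner_trial_eq hg c x, hSc, dotProduct]
  have hzz : ‖z‖ ^ 2 ≤ μ * S := by rw [hz, norm_sq_trial hG c, hSc]; exact hμx
  have hcs : S ≤ ‖z‖ * ‖x‖ := by rw [← hzx]; exact real_inner_le_norm z x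
  have hsq : S * S ≤ μ * ‖x‖ ^ 2 * S := by
    calc S * S ≤ (‖z‖ * ‖x‖) * (‖z‖ * ‖x‖) := mul_self_le_mul_self hS0 hcs
      _ = ‖z‖ ^ 2 * ‖x‖ ^ 2 := by ring
      _ ≤ (μ * S) * ‖x‖ ^ 2 := mul_le_mul_of_nonneg_right hzz (sq_nonneg _)
      _ = μ * ‖x‖ ^ 2 * S := by ring
  rcases hS0.lt_or_eq with hpos | hzero
  · exact le_of_mul_le_mul_right hsq hpos
  · rw [← hzero]; positivity

/-- **The form at a Ritz witness.** If `σ cᵀc ≤ cᵀGc` with `σ > 0`, `c ≠ 0`, and the form of `T` factors at the trial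
vector `x = Z c` (`⟪x, T x⟫ = ⟪A x, 𝒦 (A x)⟫`), then `x ≠ 0` and `σ‖x‖² ≤ ⟪x, T x⟫`:
`⟪x, Tx⟫ ≥ ‖G c‖² ≥ (cᵀGc)²/(cᵀc) ≥ σ cᵀGc = σ‖x‖²`. [cite: HornJohnson2013, Thm 4.3.21] -/
theorem form_trial_ge (h𝒦 : 𝒦.IsPositive) (hf : Orthonormal ℝ f) (hq : ∀ i, 𝒦 (f i) = q i • f i)
    (hg : ∀ i x, ⟪g i, x⟫_ℝ = ⟪f i, A x⟫_ℝ) (hG : ∀ i j, G i j = √(q i) * √(q j) * ⟪g i, g j⟫_ℝ)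
    {σ : ℝ} (hσ0 : 0 < σ) {c : ι → ℝ} (hc : 0 < c ⬝ᵥ c) (hσ : σ * (c ⬝ᵥ c) ≤ c ⬝ᵥ (G *ᵥ c))
    (hTx : ⟪∑ i, (c i * √(q i)) • g i, T (∑ i, (c i * √(q i)) • g i)⟫_ℝ =
      ⟪A (∑ i, (c i * √(q i)) • g i), 𝒦 (A (∑ i, (c i * √(q i)) • g i))⟫_ℝ) :
    0 < ‖∑ i, (c i * √(q i)) • g i‖ ^ 2 ∧
      σ * ‖∑ i, (c i * √(q i)) • g i‖ ^ 2 ≤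
        ⟪∑ i, (c i * √(q i)) • g i, T (∑ i, (c i * √(q i)) • g i)⟫_ℝ := by
  have hq0 : ∀ i, 0 ≤ q i := kept_weight_nonneg 𝒦 h𝒦 hf hq
  have hGc : 0 < c ⬝ᵥ (G *ᵥ c) := lt_of_lt_of_le (mul_pos hσ0 hc) hσ
  set x : E := ∑ i, (c i * √(q i)) • g i with hx
  have hxx : ‖x‖ ^ 2 = c ⬝ᵥ (G *ᵥ c) := norm_sq_trial hG c
  refine ⟨by rw [hxx]; exact hGc, ?_⟩
  have hkept : ∑ i, q i * ⟪f i, A x⟫_ℝ ^ 2 = (G *ᵥ c) ⬝ᵥ (G *ᵥ c) := by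
    rw [keptForm_eq_sum_sq hq0 x, dotProduct]
    refine Finset.sum_congr rfl fun i _ => ?_
    rw [hx, keptCoeff_trial hg hG c i, sq]
  have hCS : (c ⬝ᵥ (G *ᵥ c)) * (c ⬝ᵥ (G *ᵥ c)) ≤ (c ⬝ᵥ c) * ((G *ᵥ c) ⬝ᵥ (G *ᵥ c)) := by
    have h := real_inner_mul_inner_self_le (toLp 2 c : EuclideanSpace ℝ ι) (toLp 2 (G *ᵥ c))
    simp only [EuclideanSpace.inner_toLp_toLp, star_trivial, dotProduct_comm (G *ᵥ c) c] at h
    exact h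
  have hTx' : (G *ᵥ c) ⬝ᵥ (G *ᵥ c) ≤ ⟪x, T x⟫_ℝ := by
    rw [hTx, ← hkept]
    exact sum_le_inner_kinetic 𝒦 h𝒦 hf hq (A x)
  have h1 : σ * (c ⬝ᵥ (G *ᵥ c)) * (c ⬝ᵥ c) ≤ (G *ᵥ c) ⬝ᵥ (G *ᵥ c) * (c ⬝ᵥ c) := by
    calc σ * (c ⬝ᵥ (G *ᵥ c)) * (c ⬝ᵥ c) = (σ * (c ⬝ᵥ c)) * (c ⬝ᵥ (G *ᵥ c)) := by ring
      _ ≤ (c ⬝ᵥ (G *ᵥ c)) * (c ⬝ᵥ (G *ᵥ c)) := mul_le_mul_of_nonneg_right hσ hGc.le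
      _ ≤ (c ⬝ᵥ c) * ((G *ᵥ c) ⬝ᵥ (G *ᵥ c)) := hCS
      _ = (G *ᵥ c) ⬝ᵥ (G *ᵥ c) * (c ⬝ᵥ c) := by ring
  rw [hxx]
  exact (le_of_mul_le_mul_right h1 hc).trans hTx'

end Trial

/-! ### §7 Level 1, certificate forms -/

section SecondLevel

variable {E F : Type*} [NormedAddCommGroup E] [InnerProductSpace ℝ E] [NormedAddCommGroup F]
  [InnerProductSpace ℝ F] {ι : Type*} [Fintype ι]
  {T Q : E →L[ℝ] E} {A : E →L[ℝ] F} {𝒦 : F →L[ℝ] F} {f : ι → F} {q : ι → ℝ} {g : ι → E} {G : Matrix ι ι ℝ}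

omit [Fintype ι] in
/-- A two-dimensional orthonormal pencil on which `T` is `T`-orthogonal: for `ψ = aΩ + bφ` one has `‖ψ‖² = a² + b²`
and `⟪ψ, T ψ⟫ = a²⟪Ω, TΩ⟫ + b²⟪φ, Tφ⟫ ≥ ℓ‖ψ‖²` (symmetric `T`, `⟪Ω, Tφ⟫ = 0`). [folklore] -/
theorem form_combination_ge (hTsym : (T : E →ₗ[ℝ] E).IsSymmetric) {Ω φ : E} (hΩ1 : ‖Ω‖ = 1) (hφ1 : ‖φ‖ = 1)
    (hΩφ : ⟪Ω, φ⟫_ℝ = 0) (hΩTφ : ⟪Ω, T φ⟫_ℝ = 0) {ℓ : ℝ} (hℓΩ : ℓ ≤ ⟪Ω, T Ω⟫_ℝ) (hℓφ : ℓ ≤ ⟪φ, T φ⟫_ℝ)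
    (a b : ℝ) :
    ‖a • Ω + b • φ‖ ^ 2 = a ^ 2 + b ^ 2 ∧ ℓ * ‖a • Ω + b • φ‖ ^ 2 ≤ ⟪a • Ω + b • φ, T (a • Ω + b • φ)⟫_ℝ := by
  have hnorm : ‖a • Ω + b • φ‖ ^ 2 = a ^ 2 + b ^ 2 := by
    rw [norm_add_sq_real, norm_smul, norm_smul, hΩ1, hφ1, real_inner_smul_left, real_inner_smul_right, hΩφ]
    simp only [Real.norm_eq_abs, mul_one, sq_abs, mul_zero, add_zero]
  refine ⟨hnorm, ?_⟩
  have hφTΩ : ⟪φ, T Ω⟫_ℝ = 0 := by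
    have h := hTsym Ω φ
    simp only [ContinuousLinearMap.coe_coe] at h
    rw [real_inner_comm (T Ω) φ, h, hΩTφ]
  have hform : ⟪a • Ω + b • φ, T (a • Ω + b • φ)⟫_ℝ = a ^ 2 * ⟪Ω, T Ω⟫_ℝ + b ^ 2 * ⟪φ, T φ⟫_ℝ := by
    rw [map_add, map_smul, map_smul]
    simp only [inner_add_left, inner_add_right, real_inner_smul_left, real_inner_smul_right, hΩTφ, hφTΩ]
    ring
  rw [hnorm, hform]
  nlinarith [sq_nonneg a, sq_nonneg b]

/-- **LEVEL 1, UPPER, certificate form (deflation).**  Let `T` be symmetric and let its form factor on the sector,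
`Q x = x → ⟪x, T x⟫ = ⟪A x, 𝒦 (A x)⟫`, with `𝒦 ⪰ 0` diagonal on the orthonormal kept family (`𝒦 f_i = q_i f_i`), dropped
weights `≤ κ`, `⟪g_i, ·⟫ = ⟪f_i, A ·⟫`, `G_ij = √q_i √q_j ⟪g_i, g_j⟫`.  Suppose ONE deflation vector `u` certifies
`cᵀGc ≤ μ cᵀc` for every `c ⊥ u` (`μ ≥ 0`; e.g. from `μ·1 − G + τ u uᵀ ⪰ 0`).  If `Ω ⊥ φ` are unit vectors of the sector
(`QΩ = Ω`, `Qφ = φ`) with `⟪Ω, Tφ⟫ = 0` and `⟪Ω, TΩ⟫ ≥ ℓ`, `⟪φ, Tφ⟫ ≥ ℓ` — the vacuum and an excited eigenvector with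
eigenvalue `ℓ` — then `ℓ ≤ μ + κ‖A‖²`. [cite: HornJohnson2013, Cor 4.3.9] -/
theorem second_le_of_deflation (hTsym : (T : E →ₗ[ℝ] E).IsSymmetric)
    (hT : ∀ x, Q x = x → ⟪x, T x⟫_ℝ = ⟪A x, 𝒦 (A x)⟫_ℝ) (h𝒦 : 𝒦.IsPositive)
    (hf : Orthonormal ℝ f) (hq : ∀ i, 𝒦 (f i) = q i • f i)
    {κ : ℝ} (hκ0 : 0 ≤ κ) (hκ : ∀ z : F, (∀ i, ⟪f i, z⟫_ℝ = 0) → ⟪z, 𝒦 z⟫_ℝ ≤ κ * ‖z‖ ^ 2)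
    (hg : ∀ i x, ⟪g i, x⟫_ℝ = ⟪f i, A x⟫_ℝ) (hG : ∀ i j, G i j = √(q i) * √(q j) * ⟪g i, g j⟫_ℝ)
    {μ : ℝ} (hμ0 : 0 ≤ μ) {u : ι → ℝ} (hμ : ∀ c : ι → ℝ, u ⬝ᵥ c = 0 → c ⬝ᵥ (G *ᵥ c) ≤ μ * (c ⬝ᵥ c))
    {Ω φ : E} (hΩ : Q Ω = Ω) (hφ : Q φ = φ) (hΩ1 : ‖Ω‖ = 1) (hφ1 : ‖φ‖ = 1) (hΩφ : ⟪Ω, φ⟫_ℝ = 0)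
    (hΩTφ : ⟪Ω, T φ⟫_ℝ = 0) {ℓ : ℝ} (hℓΩ : ℓ ≤ ⟪Ω, T Ω⟫_ℝ) (hℓφ : ℓ ≤ ⟪φ, T φ⟫_ℝ) :
    ℓ ≤ μ + κ * ‖A‖ ^ 2 := by
  have hq0 : ∀ i, 0 ≤ q i := kept_weight_nonneg 𝒦 h𝒦 hf hq
  set v : E := ∑ i, (u i * √(q i)) • g i with hv
  have main : ∀ a b : ℝ, a ^ 2 + b ^ 2 ≠ 0 → ⟪a • Ω + b • φ, v⟫_ℝ = 0 → ℓ ≤ μ + κ * ‖A‖ ^ 2 := by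
    intro a b hab hψv
    set ψ : E := a • Ω + b • φ with hψ
    obtain ⟨hnorm, hge⟩ := form_combination_ge hTsym hΩ1 hφ1 hΩφ hΩTφ hℓΩ hℓφ a b
    have hψ2 : 0 < ‖ψ‖ ^ 2 := by
      rw [hψ, hnorm]
      exact lt_of_le_of_ne (by positivity) (Ne.symm hab)
    have hQψ : Q ψ = ψ := by rw [hψ, map_add, map_smul, map_smul, hΩ, hφ]
    have hu : u ⬝ᵥ (fun i => √(q i) * ⟪f i, A ψ⟫_ℝ) = 0 := by
      have h := inner_trial_eq (q := q) hg u ψ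
      rw [← hv, real_inner_comm] at h
      rw [dotProduct, ← h, hψv]
    have h1 := inner_kinetic_le_sum_add 𝒦 h𝒦 hf hq hκ0 hκ (A ψ)
    have h2 := keptForm_le_of_coeff hq0 hg hG hμ0 ψ (hμ _ hu)
    have h3 : ‖A ψ‖ ^ 2 ≤ ‖A‖ ^ 2 * ‖ψ‖ ^ 2 := by
      rw [← mul_pow]; exact pow_le_pow_left₀ (norm_nonneg _) (A.le_opNorm ψ) 2
    have h4 := mul_le_mul_of_nonneg_left h3 hκ0
    have hup : ⟪ψ, T ψ⟫_ℝ ≤ (μ + κ * ‖A‖ ^ 2) * ‖ψ‖ ^ 2 := by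
      rw [hT ψ hQψ]
      linarith
    have hlow : ℓ * ‖ψ‖ ^ 2 ≤ ⟪ψ, T ψ⟫_ℝ := by rw [hψ]; exact hge
    exact le_of_mul_le_mul_right (hlow.trans hup) hψ2
  by_cases hΩv : ⟪Ω, v⟫_ℝ = 0
  · refine main 1 0 (by norm_num) ?_
    rw [one_smul, zero_smul, add_zero, hΩv]
  · refine main ⟪φ, v⟫_ℝ (-⟪Ω, v⟫_ℝ) (fun h => hΩv (by nlinarith [sq_nonneg ⟪φ, v⟫_ℝ, sq_nonneg ⟪Ω, v⟫_ℝ])) ?_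
    rw [inner_add_left, real_inner_smul_left, real_inner_smul_left]
    ring

/-- **LEVEL 1, LOWER, certificate form (two Ritz vectors).**  With the sector factorisation
`Q x = x → ⟪x, T x⟫ = ⟪A x, 𝒦 (A x)⟫`, `𝒦 ⪰ 0` diagonal on the orthonormal kept family, `⟪g_i, ·⟫ = ⟪f_i, A ·⟫`,
`Q g_i = g_i`, `G_ij = √q_i √q_j ⟪g_i, g_j⟫`: two linearly independent coefficient vectors `c₀, c₁` whose pencil has
Ritz values `≥ σ > 0` (`σ‖a c₀ + b c₁‖² ≤ (a c₀ + b c₁)ᵀ G (a c₀ + b c₁)` for all `a, b`) give, for EVERY vector `Ω`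
(the vacuum, which need not be known), a state `x ≠ 0` of the sector with `⟪Ω, x⟫ = 0` and `σ‖x‖² ≤ ⟪x, T x⟫`.
[cite: HornJohnson2013, Thm 4.3.21] -/
theorem exists_trial_orthogonal_of_two_ritz
    (hT : ∀ x, Q x = x → ⟪x, T x⟫_ℝ = ⟪A x, 𝒦 (A x)⟫_ℝ) (h𝒦 : 𝒦.IsPositive)
    (hf : Orthonormal ℝ f) (hq : ∀ i, 𝒦 (f i) = q i • f i)
    (hg : ∀ i x, ⟪g i, x⟫_ℝ = ⟪f i, A x⟫_ℝ) (hgQ : ∀ i, Q (g i) = g i)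
    (hG : ∀ i j, G i j = √(q i) * √(q j) * ⟪g i, g j⟫_ℝ)
    {σ : ℝ} (hσ0 : 0 < σ) {c₀ c₁ : ι → ℝ} (hind : ∀ a b : ℝ, a • c₀ + b • c₁ = 0 → a = 0 ∧ b = 0)
    (hσ : ∀ a b : ℝ, σ * ((a • c₀ + b • c₁) ⬝ᵥ (a • c₀ + b • c₁)) ≤
      (a • c₀ + b • c₁) ⬝ᵥ (G *ᵥ (a • c₀ + b • c₁))) (Ω : E) :
    ∃ x : E, x ≠ 0 ∧ Q x = x ∧ ⟪Ω, x⟫_ℝ = 0 ∧ σ * ‖x‖ ^ 2 ≤ ⟪x, T x⟫_ℝ := by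
  set x₀ : E := ∑ i, (c₀ i * √(q i)) • g i with hx₀
  set x₁ : E := ∑ i, (c₁ i * √(q i)) • g i with hx₁
  have main : ∀ a b : ℝ, (a ≠ 0 ∨ b ≠ 0) → a * ⟪Ω, x₀⟫_ℝ + b * ⟪Ω, x₁⟫_ℝ = 0 →
      ∃ x : E, x ≠ 0 ∧ Q x = x ∧ ⟪Ω, x⟫_ℝ = 0 ∧ σ * ‖x‖ ^ 2 ≤ ⟪x, T x⟫_ℝ := by
    intro a b hab horth
    set c : ι → ℝ := a • c₀ + b • c₁ with hc
    have hc0 : c ≠ 0 := by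
      intro h
      obtain ⟨ha, hb⟩ := hind a b (by rw [← hc, h])
      exact hab.elim (fun h' => h' ha) (fun h' => h' hb)
    have hcc : 0 < c ⬝ᵥ c :=
      lt_of_le_of_ne (Finset.sum_nonneg fun i _ => mul_self_nonneg (c i))
        (fun h => hc0 (dotProduct_self_eq_zero.mp h.symm))
    set x : E := ∑ i, (c i * √(q i)) • g i with hx
    have hxdec : x = a • x₀ + b • x₁ := by
      rw [hx, hc, trial_add, trial_smul, trial_smul]
    have hQx : Q x = x := apply_trial_eq hgQ c
    obtain ⟨hpos, hge⟩ := form_trial_ge (T := T) h𝒦 hf hq hg hG hσ0 hcc (hσ a b) (hT x hQx)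
    refine ⟨x, ?_, hQx, ?_, hge⟩
    · intro h
      rw [← hx, h, norm_zero] at hpos
      norm_num at hpos
    · rw [hxdec, inner_add_right, real_inner_smul_right, real_inner_smul_right, horth]
  by_cases h0 : ⟪Ω, x₀⟫_ℝ = 0
  · exact main 1 0 (Or.inl one_ne_zero) (by rw [h0]; ring)
  · exact main ⟪Ω, x₁⟫_ℝ (-⟪Ω, x₀⟫_ℝ) (Or.inr (neg_ne_zero.mpr h0)) (by ring)

end SecondLevel

/-! ### §8 Level 1, eigenvalue forms (`Matrix.IsHermitian.eigenvalues₀` of the kept block, `|ι| ≥ 2`) -/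

section Eigenvalue

variable {E F : Type*} [NormedAddCommGroup E] [InnerProductSpace ℝ E] [NormedAddCommGroup F]
  [InnerProductSpace ℝ F] {ι : Type*} [Fintype ι] [DecidableEq ι]
  {T Q : E →L[ℝ] E} {A : E →L[ℝ] F} {𝒦 : F →L[ℝ] F} {f : ι → F} {q : ι → ℝ} {g : ι → E} {G : Matrix ι ι ℝ}

omit [DecidableEq ι] in
/-- `⟪c, d⟫ = cᵀd` on `EuclideanSpace ℝ ι`. [folklore] -/
theorem inner_toLp_toLp_real (c d : ι → ℝ) : ⟪(toLp 2 c : EuclideanSpace ℝ ι), toLp 2 d⟫_ℝ = c ⬝ᵥ d := by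
  rw [EuclideanSpace.inner_toLp_toLp, star_trivial, dotProduct_comm]

/-- `⟪G c, c⟫ = cᵀ G c` on `EuclideanSpace ℝ ι`. [folklore] -/
theorem inner_toEuclideanLin_toLp_real (c : ι → ℝ) :
    ⟪toEuclideanLin G (toLp 2 c : EuclideanSpace ℝ ι), toLp 2 c⟫_ℝ = c ⬝ᵥ (G *ᵥ c) := by
  rw [real_inner_comm, inner_self_toEuclideanLin]
  simp only [star_trivial]

/-- **Deflated Rayleigh bound**: `cᵀGc ≤ λ↓₁ cᵀc` for every `c` orthogonal to the TOP eigenvector `b₀`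
(Courant–Fischer at level `1`, tree `re_inner_apply_self_le_of_inner_eq_zero`). [cite: HornJohnson2013, Thm 4.2.6] -/
theorem dotProduct_mulVec_le_eigenvalues₀_one (hGh : G.IsHermitian) (h1 : 1 < Fintype.card ι) (c : ι → ℝ)
    (hc : ofLp ((isSymmetric_toEuclideanLin_iff.mpr hGh).eigenvectorBasis finrank_euclideanSpace
      ⟨0, Nat.zero_lt_of_lt h1⟩) ⬝ᵥ c = 0) :
    c ⬝ᵥ (G *ᵥ c) ≤ hGh.eigenvalues₀ ⟨1, h1⟩ * (c ⬝ᵥ c) := by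
  have hS : (toEuclideanLin G).IsSymmetric := isSymmetric_toEuclideanLin_iff.mpr hGh
  have h := re_inner_apply_self_le_of_inner_eq_zero hS finrank_euclideanSpace ⟨1, h1⟩ (x := toLp 2 c)
    (fun i hi => by
      have hi0 : i = ⟨0, Nat.zero_lt_of_lt h1⟩ := Fin.ext (Nat.lt_one_iff.mp hi)
      have h := inner_toLp_toLp_real (ofLp (hS.eigenvectorBasis finrank_euclideanSpace ⟨0, Nat.zero_lt_of_lt h1⟩)) c
      rw [toLp_ofLp] at h
      rw [hi0, h, hc])
  rwa [RCLike.re_to_real, inner_toEuclideanLin_toLp_real, ← real_inner_self_eq_norm_sq, inner_toLp_toLp_real] at h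

/-- `λ↓₁(G) ≥ 0` for a kept Galerkin block (`cᵀGc = ‖Z c‖² ≥ 0`, tested at the second eigenvector, which is orthogonal
to the first). [folklore] -/
theorem eigenvalues₀_one_nonneg (hG : ∀ i j, G i j = √(q i) * √(q j) * ⟪g i, g j⟫_ℝ) (hGh : G.IsHermitian)
    (h1 : 1 < Fintype.card ι) : 0 ≤ hGh.eigenvalues₀ ⟨1, h1⟩ := by
  have hS : (toEuclideanLin G).IsSymmetric := isSymmetric_toEuclideanLin_iff.mpr hGh
  set b := hS.eigenvectorBasis finrank_euclideanSpace with hb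
  set c : ι → ℝ := ofLp (b ⟨1, h1⟩) with hc
  have horth : ofLp (b ⟨0, Nat.zero_lt_of_lt h1⟩) ⬝ᵥ c = 0 := by
    rw [hc, ← inner_toLp_toLp_real, toLp_ofLp, toLp_ofLp]
    exact b.orthonormal.2 (by simp [Fin.ext_iff])
  have h := dotProduct_mulVec_le_eigenvalues₀_one hGh h1 c horth
  have hcc : c ⬝ᵥ c = 1 := by
    rw [hc, ← inner_toLp_toLp_real, toLp_ofLp, real_inner_self_eq_norm_sq, b.orthonormal.1, one_pow]
  have hGc : 0 ≤ c ⬝ᵥ (G *ᵥ c) := by rw [← norm_sq_trial hG c]; positivity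
  rw [hcc, mul_one] at h
  exact hGc.trans h

/-- **Two-vector Ritz pencil**: on the span of the top two eigenvectors `b₀, b₁` the quadratic form is `≥ λ↓₁ ·‖c‖²`
(Courant–Fischer, tree `le_re_inner_apply_self_of_inner_eq_zero`), and `b₀, b₁` are linearly independent.
[cite: HornJohnson2013, Thm 4.2.6] -/
theorem eigenvalues₀_one_mul_le_of_span (hGh : G.IsHermitian) (h1 : 1 < Fintype.card ι) :
    let b := (isSymmetric_toEuclideanLin_iff.mpr hGh).eigenvectorBasis finrank_euclideanSpace
    (∀ a a' : ℝ, a • ofLp (b ⟨0, Nat.zero_lt_of_lt h1⟩) + a' • ofLp (b ⟨1, h1⟩) = 0 → a = 0 ∧ a' = 0) ∧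
    (∀ a a' : ℝ, hGh.eigenvalues₀ ⟨1, h1⟩ *
        ((a • ofLp (b ⟨0, Nat.zero_lt_of_lt h1⟩) + a' • ofLp (b ⟨1, h1⟩)) ⬝ᵥ
          (a • ofLp (b ⟨0, Nat.zero_lt_of_lt h1⟩) + a' • ofLp (b ⟨1, h1⟩))) ≤
      (a • ofLp (b ⟨0, Nat.zero_lt_of_lt h1⟩) + a' • ofLp (b ⟨1, h1⟩)) ⬝ᵥ
        (G *ᵥ (a • ofLp (b ⟨0, Nat.zero_lt_of_lt h1⟩) + a' • ofLp (b ⟨1, h1⟩)))) := by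
  intro b
  have hS : (toEuclideanLin G).IsSymmetric := isSymmetric_toEuclideanLin_iff.mpr hGh
  have h01 : (⟨0, Nat.zero_lt_of_lt h1⟩ : Fin (Fintype.card ι)) ≠ ⟨1, h1⟩ := by simp [Fin.ext_iff]
  have hvec : ∀ a a' : ℝ, (toLp 2 (a • ofLp (b ⟨0, Nat.zero_lt_of_lt h1⟩) + a' • ofLp (b ⟨1, h1⟩)) :
      EuclideanSpace ℝ ι) = a • b ⟨0, Nat.zero_lt_of_lt h1⟩ + a' • b ⟨1, h1⟩ := by
    intro a a'
    rw [toLp_add, toLp_smul, toLp_smul, toLp_ofLp, toLp_ofLp]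
  refine ⟨fun a a' h => ?_, fun a a' => ?_⟩
  · have hx : a • b ⟨0, Nat.zero_lt_of_lt h1⟩ + a' • b ⟨1, h1⟩ = 0 := by
      rw [← hvec, h, toLp_zero]
    have ha := congrArg (fun y => ⟪b ⟨0, Nat.zero_lt_of_lt h1⟩, y⟫_ℝ) hx
    have ha' := congrArg (fun y => ⟪b ⟨1, h1⟩, y⟫_ℝ) hx
    simp only [inner_add_right, real_inner_smul_right, inner_zero_right,
      real_inner_self_eq_norm_sq, b.orthonormal.1, b.orthonormal.2 h01, b.orthonormal.2 h01.symm] at ha ha'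
    constructor <;> linarith
  · have h := le_re_inner_apply_self_of_inner_eq_zero hS finrank_euclideanSpace ⟨1, h1⟩
      (x := a • b ⟨0, Nat.zero_lt_of_lt h1⟩ + a' • b ⟨1, h1⟩) (fun i hi => by
        have hi0 : i ≠ ⟨0, Nat.zero_lt_of_lt h1⟩ := fun h => by
          rw [h, Fin.lt_def] at hi; exact Nat.not_lt_zero _ hi
        have hi1 : i ≠ ⟨1, h1⟩ := fun h => by rw [h] at hi; exact lt_irrefl _ hi
        rw [inner_add_right, real_inner_smul_right, real_inner_smul_right, b.orthonormal.2 hi0,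
          b.orthonormal.2 hi1, mul_zero, mul_zero, add_zero])
    rw [← hvec, RCLike.re_to_real, inner_toEuclideanLin_toLp_real, ← real_inner_self_eq_norm_sq,
      inner_toLp_toLp_real] at h
    exact h

/-- **LEVEL 1, UPPER**: `ℓ ≤ λ↓₁(G) + κ‖A‖²` for the second level `ℓ` of the sector witnessed by orthonormal `Ω`, `φ`
as in `second_le_of_deflation`, with the exact second eigenvalue of the kept Galerkin block (the operator-level form of
`KWeightTail.eigenvalues₀_le_compressed_add` at `k = 1`). [cite: HornJohnson2013, Thm 4.3.1] -/
theorem second_le_eigenvalues₀_one_add (hTsym : (T : E →ₗ[ℝ] E).IsSymmetric)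
    (hT : ∀ x, Q x = x → ⟪x, T x⟫_ℝ = ⟪A x, 𝒦 (A x)⟫_ℝ) (h𝒦 : 𝒦.IsPositive)
    (hf : Orthonormal ℝ f) (hq : ∀ i, 𝒦 (f i) = q i • f i)
    {κ : ℝ} (hκ0 : 0 ≤ κ) (hκ : ∀ z : F, (∀ i, ⟪f i, z⟫_ℝ = 0) → ⟪z, 𝒦 z⟫_ℝ ≤ κ * ‖z‖ ^ 2)
    (hg : ∀ i x, ⟪g i, x⟫_ℝ = ⟪f i, A x⟫_ℝ) (hG : ∀ i j, G i j = √(q i) * √(q j) * ⟪g i, g j⟫_ℝ)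
    (hGh : G.IsHermitian) (h1 : 1 < Fintype.card ι)
    {Ω φ : E} (hΩ : Q Ω = Ω) (hφ : Q φ = φ) (hΩ1 : ‖Ω‖ = 1) (hφ1 : ‖φ‖ = 1) (hΩφ : ⟪Ω, φ⟫_ℝ = 0)
    (hΩTφ : ⟪Ω, T φ⟫_ℝ = 0) {ℓ : ℝ} (hℓΩ : ℓ ≤ ⟪Ω, T Ω⟫_ℝ) (hℓφ : ℓ ≤ ⟪φ, T φ⟫_ℝ) :
    ℓ ≤ hGh.eigenvalues₀ ⟨1, h1⟩ + κ * ‖A‖ ^ 2 :=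
  second_le_of_deflation hTsym hT h𝒦 hf hq hκ0 hκ hg hG (eigenvalues₀_one_nonneg hG hGh h1)
    (fun c hc => dotProduct_mulVec_le_eigenvalues₀_one hGh h1 c hc) hΩ hφ hΩ1 hφ1 hΩφ hΩTφ hℓΩ hℓφ

/-- **LEVEL 1, LOWER**: if `λ↓₁(G) > 0` then for EVERY vector `Ω` there is a state `x ≠ 0` of the sector, orthogonal
to `Ω`, with `λ↓₁(G)‖x‖² ≤ ⟪x, T x⟫` (the operator-level form of `KWeightTail.eigenvalues₀_compressed_le` at `k = 1`:
combined with `⟪x, T x⟫ ≤ λ̂*‖x‖²` for sector states `x ⊥` vacuum it gives `λ↓₁(G) ≤ λ̂*`).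
[cite: HornJohnson2013, Thm 4.3.21] -/
theorem exists_trial_orthogonal_eigenvalues₀_one
    (hT : ∀ x, Q x = x → ⟪x, T x⟫_ℝ = ⟪A x, 𝒦 (A x)⟫_ℝ) (h𝒦 : 𝒦.IsPositive)
    (hf : Orthonormal ℝ f) (hq : ∀ i, 𝒦 (f i) = q i • f i)
    (hg : ∀ i x, ⟪g i, x⟫_ℝ = ⟪f i, A x⟫_ℝ) (hgQ : ∀ i, Q (g i) = g i)
    (hG : ∀ i j, G i j = √(q i) * √(q j) * ⟪g i, g j⟫_ℝ) (hGh : G.IsHermitian) (h1 : 1 < Fintype.card ι)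
    (hpos : 0 < hGh.eigenvalues₀ ⟨1, h1⟩) (Ω : E) :
    ∃ x : E, x ≠ 0 ∧ Q x = x ∧ ⟪Ω, x⟫_ℝ = 0 ∧ hGh.eigenvalues₀ ⟨1, h1⟩ * ‖x‖ ^ 2 ≤ ⟪x, T x⟫_ℝ := by
  obtain ⟨hind, hσ⟩ := eigenvalues₀_one_mul_le_of_span hGh h1
  exact exists_trial_orthogonal_of_two_ritz hT h𝒦 hf hq hg hgQ hG hpos hind hσ Ω

end Eigenvalue

end KWeightTailOperator

end Summit.Ventures.YMGap.FlowData
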